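import Summits.FinalStateConjecture.FinalStateConjecture.Theorems.PhotonSphereChannelsChannelsResolveTameDevelopmentsRSchwarzschildEndCausal
import Summits.FinalStateConjecture.FinalStateConjecture.Theorems.PhotonSphereChannelsKerrDevDefs
import HarnessLib

/-!
# Route PhotonSphereChannels · crux `ChannelsResolveTameDevelopmentsR` (K2R-T2, stmt-FinalStateConjecture-17430) —
# the SCHWARZSCHILD END, II: end data of the horizon-penetrating Kerr–Schild patch whose far chart is the
# INCLUSION of the far cylinder — far deviation `0`, non-radiating, d.o.c. `= {r > 2M}` an EXACT Kerr
# `(M, 0)` exterior, horizon `= {r = 2M} ≠ ∅`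

File I (`…RSchwarzschildEndCausal.lean`) computed the causal anatomy of the far cylinder `cyl_R = {r > R}` of
the patch `Kerr.spacetime M 0 r₁` (`0 < r₁ ≤ 2M ≤ R`). Here we read it on END DATA of the hull interface
(`TameHullDefs.EndDatum`): for every end datum `E` of the patch whose far chart is, pointwise, the inclusion of
the cylinder `Kerr.region 0 E.R` (`hfar : ∀ y, (E.far y).1 = y.1`) and whose reference mass is `E.M = M`:

* `Schw.h_eq_zero`, `Schw.hdot_eq_zero`, `Schw.far_bound_of_far`, `Schw.isNonRadiating_of_far` — the far
  deviation `ι^* g_{M,0} − g_{M,0}` vanishes identically, so the `r`-weighted `C³` far bound holds with any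
  `E.C ≥ 0` and the end is two-sided NON-RADIATING (`EndDatum.IsNonRadiating`);
* `Schw.far_isLocalDiffeomorph_of_far`, `Schw.far_injective_of_far`, `Schw.far_future_of_far` — the far-chart
  clauses of `EndDatum.IsTameEnd` (`∂₀` is future timelike on `{r > 2M}`);
* `Schw.clock_far_of_radial`, `Schw.clock_smooth_of_radial` — the clock clauses for every clock of the form
  `x⁰ + F(r)` with `F` smooth and `F = 0` beyond `E.R` (file IV takes `F` = the Painlevé–Gullstrand correction);
* `Schw.doc_eq_of_far`, `Schw.horizon_eq_of_far`, `Schw.horizon_nonempty_of_far`, `Schw.closure_doc_eq_of_far` —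
  `E.doc = {r > 2M}`, `E.horizon = {r = 2M}` (nonempty for `r₁ < 2M`), `closure E.doc = E.doc ∪ E.horizon`;
* `Schw.isKerrDoc_doc_of_far` — **the d.o.c. of the end is an EXACT Kerr `(M, 0)` exterior** (`IsKerrDoc`, by
  the inclusion of `Kerr.exterior M 0 = {r > 2M}`): the Kerr branch of the hull dichotomies is inhabited.

Everything is proved; `[Kerr.Facts]` as in file I. No definitions (the end datum is a hypothesis-described
variable; the assembly file builds the explicit term).
References: M. Dafermos, I. Rodnianski, arXiv:0811.0354, §5.1 [DafermosRodnianski2008]; R. M. Wald,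
*General Relativity* (1984), §12.1 [Wald1984]; J. M. Lee, *Introduction to Smooth Manifolds* (2013), Thm. 4.5
[LeeSmoothManifolds2013]; M. Dafermos, J. Luk, arXiv:1710.01722, Conjecture 1 [DafermosLuk2017].
-/

noncomputable section
set_option maxSynthPendingDepth 3 -- nested operator types `E4 →L E4 →L E4 →L ℝ` (as in the tree files)
set_option linter.dupNamespace false -- `Summit.FinalStateConjecture.FinalStateConjecture.…` is the tree's layout

open TopologicalSpace Manifold Filter Topology Set Function
open scoped ContDiff Topology ENNReal Manifold NNReal

namespace Summit.FinalStateConjecture.FinalStateConjecture.Theorems.TameHull.Schw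

open Literature.Geometry.Lorentzian LorentzianMetric
open Summit.FinalStateConjecture.FinalStateConjecture.Theorems.SeamedChartsExhaust.Negative

/-! ### The inclusion of Kerr–Schild regions is a local diffeomorphism -/

/-- **The inclusion `{r > R} ↪ {r > r₁}` of Kerr–Schild regions is a `C^∞` local diffeomorphism** (at each
point it is the partial diffeomorphism onto `{v | ↑v ∈ {r > R}}` whose inverse is the identity on points).
Lee 2013, Thm. 4.5. [cite: LeeSmoothManifolds2013, Thm. 4.5] -/
-- adapted from `Literature/Barriers/SmoothPoincare4/ExoticOpenFourSpaceSmoothHeightProofs.isLocalDiffeomorph_inclusion`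
theorem isLocalDiffeomorph_regionInclusion {r₁ R : ℝ} (h : Kerr.region (0 : ℝ) R ≤ Kerr.region (0 : ℝ) r₁) :
    IsLocalDiffeomorph 𝓘(ℝ, E4) (𝓡 4) ∞
      (Opens.inclusion h : Kerr.region (0 : ℝ) R → Kerr.region (0 : ℝ) r₁) := by
  classical
  intro x
  set inv : Kerr.region (0 : ℝ) r₁ → Kerr.region (0 : ℝ) R :=
    fun v ↦ if hv : (v : E4) ∈ Kerr.region (0 : ℝ) R then ⟨v, hv⟩ else x with hinv
  have hinv_val : ∀ v : Kerr.region (0 : ℝ) r₁, (v : E4) ∈ Kerr.region (0 : ℝ) R →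
      ((inv v : Kerr.region (0 : ℝ) R) : E4) = v := fun v hv ↦ by
    simp only [hinv, dif_pos hv]
  have htarget : IsOpen {v : Kerr.region (0 : ℝ) r₁ | (v : E4) ∈ Kerr.region (0 : ℝ) R} :=
    (Kerr.region (0 : ℝ) R).2.preimage continuous_subtype_val
  refine ⟨{ toFun := Opens.inclusion h
            invFun := inv
            source := univ
            target := {v | (v : E4) ∈ Kerr.region (0 : ℝ) R}
            map_source' := fun u _ ↦ u.2
            map_target' := fun _ _ ↦ mem_univ _
            left_inv' := fun u _ ↦ Subtype.ext (hinv_val _ u.2)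
            right_inv' := fun v hv ↦ Subtype.ext (hinv_val v hv)
            open_source := isOpen_univ
            open_target := htarget
            contMDiffOn_toFun := (contMDiff_inclusion h).contMDiffOn
            contMDiffOn_invFun := ?_ }, mem_univ _, fun _ _ ↦ rfl⟩
  intro v₀ hv₀
  refine ContMDiffAt.contMDiffWithinAt ?_
  rw [← ContMDiffAt.subtypeVal_comp_iff]
  have hev : Subtype.val ∘ inv =ᶠ[𝓝 v₀] (Subtype.val : Kerr.region (0 : ℝ) r₁ → E4) := by
    filter_upwards [htarget.mem_nhds hv₀] with v hv
    exact hinv_val v hv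
  exact contMDiff_subtype_val.contMDiffAt.congr_of_eventuallyEq hev

section Patch

variable [Kerr.Facts] {M r₁ : ℝ} {hM : 0 ≤ M} (E : EndDatum (Kerr.spacetime M 0 r₁ hM))

/-! ### End data whose far chart is the inclusion of the far cylinder -/

/-- If the far chart is pointwise the inclusion, the far cylinder lies in the patch. [folklore] -/
theorem farCylinder_le_of_far (hfar : ∀ y, (E.far y).1 = y.1) : Kerr.region (0 : ℝ) E.R ≤ Kerr.region 0 r₁ :=
  fun y hy ↦ by
    have h := (E.far ⟨y, hy⟩).2
    rwa [hfar] at h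

/-- … and the far chart IS the inclusion. [folklore] -/
theorem far_eq_inclusion (hfar : ∀ y, (E.far y).1 = y.1) :
    E.far = Opens.inclusion (farCylinder_le_of_far E hfar) :=
  funext fun y ↦ Subtype.ext (hfar y)

/-- The differential of such a far chart is the identity. [folklore] -/
theorem mfderiv_far_apply (hfar : ∀ y, (E.far y).1 = y.1) (y : Kerr.region (0 : ℝ) E.R) (v : E4) :
    mfderiv 𝓘(ℝ, E4) (𝓡 4) E.far y v = v := by
  rw [far_eq_inclusion E hfar]
  exact OpensChart.mfderiv_inclusion_apply _ y v

/-- **The far deviation vanishes identically**: `ι^* g_{M,0} − g_{M,0} = 0` on the cylinder (and the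
extension by zero is `0` off it). [cite: arXiv08110354, §5.1] -/
theorem h_eq_zero (hfar : ∀ y, (E.far y).1 = y.1) (hEM : E.M = M) : E.h = 0 := by
  funext z
  by_cases hz : z ∈ Kerr.region (0 : ℝ) E.R
  · have hc := (Kerr.spacetime M 0 r₁ hM).deviationExtend_coe E.B E.far ⟨z, hz⟩
    change (Kerr.spacetime M 0 r₁ hM).deviationExtend E.B E.far z = 0
    rw [hc]
    ext v w
    have e1 := mfderiv_far_apply E hfar ⟨z, hz⟩ v
    have e2 := mfderiv_far_apply E hfar ⟨z, hz⟩ w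
    rw [Spacetime.deviation_apply]
    erw [e1, e2]
    change Kerr.bilin M 0 (E.far ⟨z, hz⟩).1 v w - Kerr.bilin E.M 0 z v w = 0
    rw [hfar, hEM]
    exact sub_self _
  · exact (Kerr.spacetime M 0 r₁ hM).deviationExtend_of_not_mem _ _ hz

/-- … hence so does its chart-time derivative. [folklore] -/
theorem hdot_eq_zero (hfar : ∀ y, (E.far y).1 = y.1) (hEM : E.M = M) : E.hdot = 0 := by
  funext y
  change fderiv ℝ E.h y (E4.basisVector 0) = 0
  rw [h_eq_zero E hfar hEM]
  simp

/-- The `r`-weighted `C³` far bound of `IsTameEnd` holds (with `h = 0`) for every `E.C ≥ 0`. [folklore] -/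
theorem far_bound_of_far (hfar : ∀ y, (E.far y).1 = y.1) (hEM : E.M = M) (hC : 0 ≤ E.C) :
    ∀ m ≤ 3, ∀ x : Kerr.region (0 : ℝ) E.R, ‖iteratedFDeriv ℝ m E.h x.1‖ * Kerr.radius 0 x.1 ≤ E.C := by
  intro m _ x
  rw [h_eq_zero E hfar hEM, iteratedFDeriv_zero (𝕜 := ℝ)]
  simpa using hC

/-- **The end is two-sided non-radiating** (`EndDatum.IsNonRadiating`: `r ‖D^m ∂₀ h‖ → 0`, here `∂₀ h = 0`).
[cite: AlexakisSchlue2018, Thm. 1.1] -/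
theorem isNonRadiating_of_far (hfar : ∀ y, (E.far y).1 = y.1) (hEM : E.M = M) : E.IsNonRadiating :=
  fun m _ δ hδ ↦ ⟨0, fun x _ ↦ by
    rw [hdot_eq_zero E hfar hEM, iteratedFDeriv_zero (𝕜 := ℝ)]
    simpa using hδ.le⟩

/-- The far chart is injective. [folklore] -/
theorem far_injective_of_far (hfar : ∀ y, (E.far y).1 = y.1) : Injective E.far := fun y y' h ↦
  Subtype.ext (by rw [← hfar y, ← hfar y', h])

/-- The far chart is a `C^∞` local diffeomorphism of the cylinder. [cite: LeeSmoothManifolds2013, Thm. 4.5] -/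
theorem far_isLocalDiffeomorph_of_far (hfar : ∀ y, (E.far y).1 = y.1) :
    IsLocalDiffeomorph 𝓘(ℝ, E4) (𝓡 4) ∞ E.far := by
  rw [far_eq_inclusion E hfar]
  exact isLocalDiffeomorph_regionInclusion _

/-- **The far chart's `∂₀` points to the future** (`∂₀` is future-directed where `r > 2M`, and the cylinder
has `r > E.R ≥ 2M`). [cite: arXiv08110354, §5.1] -/
theorem far_future_of_far (hfar : ∀ y, (E.far y).1 = y.1) (hER : 2 * M ≤ E.R) (y : Kerr.region (0 : ℝ) E.R) :
    (Kerr.spacetime M 0 r₁ hM).timeOrientation.IsFutureDirected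
      (mfderiv 𝓘(ℝ, E4) (𝓡 4) E.far y (E4.basisVector 0)) := by
  rw [mfderiv_far_apply E hfar]
  have hy : 2 * M < Kerr.radius 0 (E.far y).1 := by
    rw [hfar]
    exact (hER.trans (le_max_left _ _)).trans_lt y.2
  exact Schw.isFutureDirected_e0 (hM := hM) (E.far y) hy

/-! ### Clocks of the form `x⁰ + F(r)` -/

/-- **The clock reads `x⁰` on the far chart** if `F` vanishes beyond `E.R`. [folklore] -/
theorem clock_far_of_radial (hfar : ∀ y, (E.far y).1 = y.1) {F : ℝ → ℝ}
    (hclock : ∀ x, E.clock x = x.1 0 + F (Kerr.radius 0 x.1)) (hF0 : ∀ r, E.R < r → F r = 0)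
    (y : Kerr.region (0 : ℝ) E.R) : E.clock (E.far y) = y.1 0 := by
  rw [hclock, hfar, hF0 _ ((le_max_left _ _).trans_lt y.2), add_zero]

omit [Kerr.Facts] in
/-- The coordinate function `x ↦ x⁰ + F(r(x))` is smooth off the time axis for smooth `F`. [folklore] -/
theorem contDiffAt_radialClock {F : ℝ → ℝ} (hF : ContDiff ℝ ∞ F) {z : E4} (hz : 0 < Kerr.radius 0 z) :
    ContDiffAt ℝ ∞ (fun z : E4 ↦ z 0 + F (Kerr.radius 0 z)) z :=
  ((EuclideanSpace.proj (0 : Fin 4)).contDiff.contDiffAt).add (hF.contDiffAt.comp z (Kerr.contDiffAt_radius hz))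

/-- **The clock `x⁰ + F(r)` is smooth on the patch** for smooth `F` (`r > r₁ ≥ 0` there). [folklore] -/
theorem clock_smooth_of_radial {F : ℝ → ℝ} (hF : ContDiff ℝ ∞ F)
    (hclock : ∀ x, E.clock x = x.1 0 + F (Kerr.radius 0 x.1)) :
    ContMDiff (𝓡 4) 𝓘(ℝ, ℝ) ∞ E.clock := fun x ↦
  (OpensChart.contMDiffAt_iff (U := Kerr.region (0 : ℝ) r₁) x E.clock (fun z : E4 ↦ z 0 + F (Kerr.radius 0 z))
    hclock).mpr (contDiffAt_radialClock hF (Kerr.radius_pos_of_mem_region x.2))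

/-! ### The d.o.c. and the horizon of the end -/

/-- **The domain of outer communications of the end is the exterior `{r > 2M}`** (file I on `range E.far`,
the far cylinder). Wald 1984, §12.1. [cite: Wald1984, §12.1] -/
theorem doc_eq_of_far (hfar : ∀ y, (E.far y).1 = y.1) (hM' : 0 < M) (hr₁ : 0 < r₁) (hr₂ : r₁ ≤ 2 * M)
    (hER : 2 * M ≤ E.R) : E.doc = {x | 2 * M < Kerr.radius 0 x.1} := by
  change (Kerr.spacetime M 0 r₁ hM).docOfEnd (Set.range E.far) = _
  rw [far_eq_inclusion E hfar]
  exact docOfEnd_farCylinder_eq (hM := hM) hM' hr₁ hr₂ (hr₂.trans hER) hER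

/-- **The future event horizon of the end is the Schwarzschild horizon `{r = 2M}`.** Wald 1984, §12.1.
[cite: Wald1984, §12.1] -/
theorem horizon_eq_of_far (hfar : ∀ y, (E.far y).1 = y.1) (hM' : 0 < M) (hr₁ : 0 < r₁) (hr₂ : r₁ ≤ 2 * M)
    (hER : 2 * M ≤ E.R) : E.horizon = {x | Kerr.radius 0 x.1 = 2 * M} := by
  change (Kerr.spacetime M 0 r₁ hM).futureEventHorizonOfEnd (Set.range E.far) = _
  rw [far_eq_inclusion E hfar]
  exact futureEventHorizonOfEnd_farCylinder_eq (hM := hM) hM' hr₁ hr₂ (hr₂.trans hER) hER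

omit [Kerr.Facts] in
/-- The Kerr–Schild radius of `(0, c, 0, 0)` is `c` for `c ≥ 0`. [folklore] -/
theorem radius_axisPoint {c : ℝ} (hc : 0 ≤ c) :
    Kerr.radius 0 (E4.ofTimeSpace 0 (c • EuclideanSpace.single (0 : Fin 3) (1 : ℝ))) = c := by
  rw [Kerr.radius_zero_left, E4.spatialNorm_ofTimeSpace, norm_smul, PiLp.norm_single, norm_one, mul_one,
    Real.norm_of_nonneg hc]

/-- **The horizon of the end is NONEMPTY** on a horizon-penetrating patch (`r₁ < 2M`): it contains
`(0, 2M, 0, 0)`. [cite: Wald1984, §12.1] -/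
theorem horizon_nonempty_of_far (hfar : ∀ y, (E.far y).1 = y.1) (hM' : 0 < M) (hr₁ : 0 < r₁)
    (hr₂ : r₁ < 2 * M) (hER : 2 * M ≤ E.R) : E.horizon.Nonempty := by
  rw [horizon_eq_of_far E hfar hM' hr₁ hr₂.le hER]
  have hmem : E4.ofTimeSpace 0 ((2 * M) • EuclideanSpace.single (0 : Fin 3) (1 : ℝ)) ∈ Kerr.region (0 : ℝ) r₁ := by
    show max r₁ 0 < Kerr.radius 0 _
    rw [radius_axisPoint (by linarith)]
    exact max_lt hr₂ (by linarith)
  exact ⟨⟨_, hmem⟩, radius_axisPoint (by linarith)⟩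

/-- **`closure E.doc = E.doc ∪ E.horizon`**: inside the patch the closure points of the exterior are the
exterior and the horizon (`closure {r > 2M} = {r ≥ 2M}`, `SchwModelT2.closure_O_eq`). [cite: Wald1984, §12.1] -/
theorem closure_doc_eq_of_far (hfar : ∀ y, (E.far y).1 = y.1) (hM' : 0 < M) (hr₁ : 0 < r₁) (hr₂ : r₁ ≤ 2 * M)
    (hER : 2 * M ≤ E.R) : closure E.doc = E.doc ∪ E.horizon := by
  let P : SchwModel.Params := ⟨M, r₁, 100 * M, hM', hr₁, hr₂, le_rfl⟩
  rw [doc_eq_of_far E hfar hM' hr₁ hr₂ hER, horizon_eq_of_far E hfar hM' hr₁ hr₂ hER]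
  have hcl : closure {x : (Kerr.spacetime M 0 r₁ hM).carrier | 2 * M < Kerr.radius 0 x.1} =
      {x | 2 * M ≤ Kerr.radius 0 x.1} :=
    ChannelsResolveTameDevelopmentsR.Negative.SchwModelT2.closure_O_eq P
  rw [hcl]
  ext x
  simp only [mem_setOf_eq, mem_union]
  exact ⟨fun h ↦ h.lt_or_eq.imp id Eq.symm, fun h ↦ h.elim le_of_lt Eq.ge⟩

/-- Horizon points are closure points of the d.o.c. (as `IsHorizonHullElement` base points must be).
[cite: Wald1984, §12.1] -/
theorem horizon_subset_closure_doc_of_far (hfar : ∀ y, (E.far y).1 = y.1) (hM' : 0 < M) (hr₁ : 0 < r₁)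
    (hr₂ : r₁ ≤ 2 * M) (hER : 2 * M ≤ E.R) : E.horizon ⊆ closure E.doc := by
  rw [closure_doc_eq_of_far E hfar hM' hr₁ hr₂ hER]
  exact subset_union_right

/-! ### The d.o.c. is an exact Kerr `(M, 0)` exterior -/

omit [Kerr.Facts] in
/-- `Kerr.exterior M 0 = {r > 2M}` lies in the patch `{r > r₁}` (`r₁ ≤ 2M`). [folklore] -/
theorem exterior_le_region (hM : 0 ≤ M) (hr₂ : r₁ ≤ 2 * M) : Kerr.exterior M 0 ≤ Kerr.region (0 : ℝ) r₁ := by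
  change Kerr.region 0 (Kerr.rPlus M 0) ≤ Kerr.region 0 r₁
  rw [Kerr.rPlus_zero_right hM]
  exact Kerr.region_mono 0 hr₂

/-- **The domain of outer communications of the end is an EXACT Kerr `(M, 0)` exterior** (`IsKerrDoc`): the
inclusion `Ψ : Kerr.exterior M 0 = {r > 2M} ↪ {r > r₁}` is injective, smooth, onto `E.doc = {r > 2M}`, pulls
`g_{M,0}` back to itself (`Ψ^* g − g_{M,0} = 0`) and maps `∂_{t*}` to a future-directed vector where `r > 2M`.
The Kerr branch `∃ M a, 0 < M ∧ |a| < M ∧ IsKerrDoc 𝓢 E.doc M a` of the hull dichotomies is thus INHABITED.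
Dafermos–Luk arXiv:1710.01722, Conjecture 1 (the predicate). [cite: DafermosLuk2017, Conjecture 1] -/
theorem isKerrDoc_doc_of_far (hfar : ∀ y, (E.far y).1 = y.1) (hM' : 0 < M) (hr₁ : 0 < r₁) (hr₂ : r₁ ≤ 2 * M)
    (hER : 2 * M ≤ E.R) : IsKerrDoc (Kerr.spacetime M 0 r₁ hM) E.doc M 0 := by
  have hext := exterior_le_region hM hr₂
  have hmemext : ∀ {z : E4}, z ∈ Kerr.exterior M 0 ↔ 2 * M < Kerr.radius 0 z := fun {z} ↦ by
    rw [Kerr.mem_exterior, Kerr.rPlus_zero_right hM, max_eq_left (by linarith)]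
  set Ψ : Kerr.exterior M 0 → (Kerr.spacetime M 0 r₁ hM).carrier := Opens.inclusion hext with hΨ
  have hdΨ : ∀ (x : Kerr.exterior M 0) (v : E4), mfderiv 𝓘(ℝ, E4) (𝓡 4) Ψ x v = v :=
    fun x v ↦ OpensChart.mfderiv_inclusion_apply hext x v
  refine ⟨Ψ, fun a b h ↦ Subtype.ext (congrArg Subtype.val h :), contMDiff_inclusion hext, ?_, ?_, ?_⟩
  · rw [doc_eq_of_far E hfar hM' hr₁ hr₂ hER]
    ext x
    constructor
    · rintro ⟨y, rfl⟩
      exact hmemext.mp y.2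
    · intro hx
      exact ⟨⟨x.1, hmemext.mpr hx⟩, rfl⟩
  · intro x
    ext v w
    rw [Spacetime.deviation_apply]
    erw [hdΨ x v, hdΨ x w]
    exact sub_self _
  · intro x hx
    rw [hdΨ]
    exact Schw.isFutureDirected_e0 (hM := hM) (Ψ x) hx

/-- **On the Schwarzschild end the Kerr branch of the dichotomy holds with sub-extremal parameters `(M, 0)`.**
[cite: DafermosLuk2017, Conjecture 1] -/
theorem exists_isKerrDoc_doc_of_far (hfar : ∀ y, (E.far y).1 = y.1) (hM' : 0 < M) (hr₁ : 0 < r₁)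
    (hr₂ : r₁ ≤ 2 * M) (hER : 2 * M ≤ E.R) :
    ∃ M' a' : ℝ, 0 < M' ∧ |a'| < M' ∧ IsKerrDoc (Kerr.spacetime M 0 r₁ hM) E.doc M' a' :=
  ⟨M, 0, hM', by rw [abs_zero]; exact hM', isKerrDoc_doc_of_far E hfar hM' hr₁ hr₂ hER⟩

end Patch

/-- Registered summary (stmt-FinalStateConjecture-17430, route seat 1): **end data of the horizon-penetrating
Schwarzschild patch with inclusion far chart** — non-radiating (`h = 0`), `doc = {r > 2M}` an exact Kerr `(M, 0)`
exterior, `horizon = {r = 2M}` nonempty and contained in `closure doc`. [cite: DafermosLuk2017, Conjecture 1] -/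
theorem schwarzschild_endDatum_far_summary : ∀ [Kerr.Facts] {M r₁ : ℝ} {hM : 0 ≤ M} (E : EndDatum (Kerr.spacetime M 0 r₁ hM)), (∀ y, (E.far y).1 = y.1) → E.M = M → 0 < M → 0 < r₁ → r₁ < 2 * M → 2 * M ≤ E.R → E.h = 0 ∧ E.IsNonRadiating ∧ E.doc = {x | 2 * M < Kerr.radius 0 x.1} ∧ E.horizon = {x | Kerr.radius 0 x.1 = 2 * M} ∧ E.horizon.Nonempty ∧ E.horizon ⊆ closure E.doc ∧ IsKerrDoc (Kerr.spacetime M 0 r₁ hM) E.doc M 0 :=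
  fun E hfar hEM hM' hr₁ hr₂ hER ↦ ⟨h_eq_zero E hfar hEM, isNonRadiating_of_far E hfar hEM,
    doc_eq_of_far E hfar hM' hr₁ hr₂.le hER, horizon_eq_of_far E hfar hM' hr₁ hr₂.le hER,
    horizon_nonempty_of_far E hfar hM' hr₁ hr₂ hER, horizon_subset_closure_doc_of_far E hfar hM' hr₁ hr₂.le hER,
    isKerrDoc_doc_of_far E hfar hM' hr₁ hr₂.le hER⟩

end Summit.FinalStateConjecture.FinalStateConjecture.Theorems.TameHull.Schw

end
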